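import Literature.Topology.FourManifolds.HomotopySpheresProofs
import Literature.Topology.FourManifolds.SmoothOrientationSphereProofs
import Literature.Topology.FourManifolds.SmoothOrientationReversingProofs
import Literature.Topology.FourManifolds.SmoothOrientationConnectedProofs
import Literature.Topology.FourManifolds.SPC4Wave0
import HarnessLib

/-!
# The group `Θₙ` of homotopy spheres: Kervaire–Milnor's Theorem 1.1, decomposed

Topic `Literature/Topology/FourManifolds`, sibling of `HomotopySpheres.lean`. This file organises
the proof of the named fact `Literature.Topology.FourManifolds.exists_commGroup_homotopySphereClass` (for `n ≠ 0, 4`, the type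
`Θₙ = HomotopySphereClass n` of oriented homotopy `n`-spheres modulo orientation-preserving
diffeomorphism is an abelian group under connected sum, with unit `[𝕊ⁿ]` and inverse `[Σ] ↦ [-Σ]`)
along the printed proof, vendors the intermediate results as named facts with their own
citations, and proves everything that is bookkeeping.

## The printed proof (Kervaire–Milnor, Ann. of Math. 77 (1963), §2, pp. 505–507)

* Lemma 2.1 (p. 505): "The connected sum operation is well defined, associative, and commutative
  up to orientation preserving diffeomorphism. The sphere `Sⁿ` serves as identity element."
  (Proof: disc theorem of Palais and Cerf; "`M # Sⁿ` is diffeomorphic to `M`" left to the reader.)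
* p. 505: "It is clear that the sum of two homotopy `n`-spheres is a homotopy `n`-sphere."
* Lemma 2.2 (p. 505): the sum is compatible with h-cobordism (not needed for the
  oriented-diffeomorphism quotient used by `HomotopySphereClass`).
* Lemma 2.3 (p. 506): a simply connected closed `M` is h-cobordant to `Sⁿ` iff it bounds a
  contractible manifold. Lemma 2.4 (p. 507): if `M` is a homotopy sphere then `M # (-M)` bounds a
  contractible manifold.
* Proof of Thm 1.1 (p. 507): Lemmas 2.1–2.2 give a well defined associative commutative operation
  with zero `Sⁿ`; Lemmas 2.3–2.4 give inverses. p. 507 also records "Clearly `Θ₁` is zero",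
  `Θ₂ = 0` (Munkres, Whitehead: smoothings of `≤ 3`-manifolds are unique) and that `Θ₃` would be
  zero if the Poincaré hypothesis were proved (now Perelman's theorem); p. 505 records Smale's
  theorem that h-cobordant homotopy spheres of dimension `≠ 3, 4` are diffeomorphic.

## The Lean decomposition

`HomotopySphereClass n` is the quotient by *oriented diffeomorphism*, so for `n ≥ 5` inverses
need Smale's h-cobordism theorem (tree fact
`HomotopySphere.isHCobordant_iff_nonempty_diffeomorph_of_five_le`) on top of Lemmas 2.3–2.4, and
for `n ≤ 3` the statement is "`Θₙ` is a point", i.e. the smooth Poincaré conjecture in dimensions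
`1, 2, 3` (tree fact `SPC4.nonemptyDiffeomorphSphere_of_mem`, spc4.S32, file `SPC4Wave0`).
Accordingly:

* `HomotopySphereClass.GroupLawFacts n` (a `Prop` structure): the class-level content of
  Lemmas 2.1–2.4 (+ Smale) in dimension `n` — products exist and are unique, associativity,
  `[𝕊ⁿ]` is a unit for every orientation of `𝕊ⁿ`, and `a # (-a) = [𝕊ⁿ]`.
  `GroupLawFacts.exists_commGroup` (**proved**, pure algebra) turns it into the conclusion of
  `exists_commGroup_homotopySphereClass` in dimension `n`.
* Manifold-level named facts (cited, not proved here):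
  `HomotopySphere.nonempty_homotopyEquiv_sphere_of_isConnectedSum` (p. 505, sums of homotopy
  spheres), `isOrientedConnectedSum_assoc` and `isOrientedConnectedSum_sphere_self` (Lemma 2.1),
  `HomotopySphere.isHCobordant_sphere_of_isOrientedConnectedSum_neg` (Lemmas 2.3–2.4), and the
  class-level `HomotopySphereClass.isMul_assoc` (Lemma 2.1) next to the tree's `isMul_exists`,
  `isMul_unique`. The case `n ≤ 3` (p. 507 + Perelman) is the existing tree fact
  `SPC4.nonemptyDiffeomorphSphere_of_mem` (spc4.S32), specialised to homotopy spheres in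
  `HomotopySphere.nonempty_diffeomorph_sphere_of_le_three_of` (proved).
* **Proved reductions**: `HomotopySphereClass.mk_sphere_eq_holds` (discharges the tree fact
  `mk_sphere_eq`: all orientations of `𝕊ⁿ`, `n ≠ 0`, give the same class — reflection of `𝕊ⁿ`);
  `exists_isMul_of` (products exist, from `exists_isOrientedConnectedSum` + p. 505);
  `isMul_sphere_of` (unit, from Lemma 2.1); `exists_isMul_neg_of` (inverses for `n ≥ 5`, from
  Lemmas 2.3–2.4 + Smale + p. 505); `subsingleton_of_nonempty_diffeomorph_sphere` and
  `exists_commGroup_of_subsingleton` (`n ≤ 3`); `groupLawFacts_of` and finally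
  `exists_commGroup_homotopySphereClass_of`: the target fact follows from the named facts above
  together with the tree facts `SPC4.nonemptyDiffeomorphSphere_of_mem`,
  `exists_isOrientedConnectedSum`, `HomotopySphereClass.isMul_unique`,
  `HomotopySphere.isHCobordant_iff_nonempty_diffeomorph_of_five_le`.

What is *not* reduced to manifold level in this file: `isMul_unique` and `isMul_assoc` need,
besides the Palais–Cerf uniqueness fact
`exists_diffeomorph_isOrientationPreserving_of_isOrientedConnectedSum` and
`isOrientedConnectedSum_assoc`, the transport of `IsOrientedConnectedSum` along oriented
diffeomorphisms of the summands (`Literature.Topology.FourManifolds.IsOrientedConnectedSum.of_diffeomorph`, sibling proofs file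
`OrientedConnectedSumTransportProofs.lean`); the resulting reductions `isMul_unique_of`,
`isMul_assoc_of` and the assembly of the target from manifold-level facts only are left to a
forthcoming sibling proofs file.

## References

* M. Kervaire, J. Milnor, *Groups of homotopy spheres I*, Ann. of Math. (2) 77 (1963), 504–537:
  Thm 1.1 (p. 504), §2 pp. 505–507 (Lemmas 2.1–2.4, proof of Thm 1.1). doi:10.2307/1970128
  [KervaireMilnorAnnals1963]
* J. Milnor, *Lectures on the h-cobordism theorem*, Princeton (1965), Thm 9.1. [MilnorHCobordism1965]
* A. Kosinski, *Differential Manifolds*, Academic Press (1993), Ch. VI §1 (connected sum, (1.3):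
  `M # Sⁿ = M`). [Kosinski1993]
* G. Perelman, arXiv:math/0211159, math/0303109, math/0307245 (2002–03): Poincaré conjecture.
  [Perelman2002]
-/

open scoped Manifold ContDiff Topology ContinuousMap
open Set Module

noncomputable section

namespace Literature.Topology.FourManifolds

/-- Local notation: `𝔼 n` is the model Euclidean space `EuclideanSpace ℝ (Fin n)`. -/
local notation "𝔼 " n:arg => EuclideanSpace ℝ (Fin n)

/-- Local notation: `𝕊 n` is the unit sphere in `EuclideanSpace ℝ (Fin (n + 1))`, the standard
`n`-sphere with its Mathlib analytic manifold structure. -/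
local notation "𝕊 " n:arg => (Metric.sphere (0 : EuclideanSpace ℝ (Fin (n + 1))) 1)

universe u

/-! ### The standard sphere as a homotopy sphere; all its orientations give one class -/

namespace HomotopySphere

variable {n : ℕ}

/-- The standard sphere `𝕊ⁿ` with the orientation `o`, as a homotopy `n`-sphere (the zero element
of `Θₙ`; Kervaire–Milnor 1963, Lemma 2.1 / proof of Thm 1.1, p. 507: "The sphere `Sⁿ` serves as
zero element"). The orientation is a parameter: no orientation of `𝕊ⁿ` is preferred here (one
exists by `isOrientable_sphere_holds`). [cite: KervaireMilnorAnnals1963, Lemma 2.1 and p. 507] -/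
protected def sphere (o : SmoothOrientation (𝓡 n) (𝕊 n)) : HomotopySphere n :=
  ⟨𝕊 n, o, ⟨.refl _⟩⟩

/-- The carrier of the standard homotopy sphere is `𝕊ⁿ` (Kervaire–Milnor 1963, §2). [cite: KervaireMilnorAnnals1963, §2] -/
@[simp] theorem sphere_carrier (o : SmoothOrientation (𝓡 n) (𝕊 n)) :
    (HomotopySphere.sphere o).carrier = (𝕊 n) := rfl

/-- The orientation of the standard homotopy sphere `HomotopySphere.sphere o` is `o`
(Kervaire–Milnor 1963, §2). [cite: KervaireMilnorAnnals1963, §2] -/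
@[simp] theorem sphere_orientation (o : SmoothOrientation (𝓡 n) (𝕊 n)) :
    (HomotopySphere.sphere o).orientation = o := rfl

/-- Reversing the orientation of the standard homotopy sphere: `-(𝕊ⁿ, o) = (𝕊ⁿ, -o)`
(Kervaire–Milnor 1963, §2). [cite: KervaireMilnorAnnals1963, §2] -/
@[simp] theorem neg_sphere (o : SmoothOrientation (𝓡 n) (𝕊 n)) :
    (HomotopySphere.sphere o).neg = HomotopySphere.sphere (-o) := rfl

/-- The standard sphere `𝕊ⁿ`, `n ≠ 0`, is connected (Mathlib `isConnected_sphere`, since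
`1 < n + 1 = rank ℝⁿ⁺¹`). [folklore] -/
theorem connectedSpace_sphere (hn : n ≠ 0) : ConnectedSpace (𝕊 n) := by
  refine isConnected_iff_connectedSpace.mp (isConnected_sphere ?_ 0 zero_le_one)
  rw [← Module.finrank_eq_rank, finrank_euclideanSpace_fin]
  exact Nat.one_lt_cast.mpr (by omega)

end HomotopySphere

namespace HomotopySphereClass

variable {n : ℕ}

/-- The class of `HomotopySphere.sphere o` is the class `[𝕊ⁿ, o]` appearing in
`exists_commGroup_homotopySphereClass` (definitional unfolding). [folklore] -/
theorem mk_sphere (o : SmoothOrientation (𝓡 n) (𝕊 n)) :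
    mk (HomotopySphere.sphere o) = mk ⟨𝕊 n, o, ⟨.refl _⟩⟩ := rfl

/-- **Discharge** of `HomotopySphereClass.mk_sphere_eq`: all orientations of `𝕊ⁿ`, `n ≠ 0`, define
the same element of `Θₙ`. Proof: `𝕊ⁿ` is connected, so an orientation `o'` is `o` or `-o`
(`SmoothOrientation.eq_or_eq_neg_of_connectedSpace_holds`, Hirsch §4.4 Thm 4.3), and the reflection
in a hyperplane is an orientation-reversing self-diffeomorphism of `𝕊ⁿ`
(`exists_diffeomorph_isOrientationReversing_sphere_holds`), i.e. an orientation-preserving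
diffeomorphism `(𝕊ⁿ, o) ≅ (𝕊ⁿ, -o)` (Kervaire–Milnor 1963, §2: `Sⁿ` is *the* zero of `Θₙ`,
whatever its orientation). [cite: KervaireMilnorAnnals1963, §2 (Lemma 2.1, p. 505)] -/
theorem mk_sphere_eq_holds : mk_sphere_eq (n := n) := by
  intro hn o o'
  haveI : ConnectedSpace (𝕊 n) := HomotopySphere.connectedSpace_sphere hn
  rcases SmoothOrientation.eq_or_eq_neg_of_connectedSpace_holds o o' with rfl | rfl
  · rfl
  · obtain ⟨φ, hφ⟩ := exists_diffeomorph_isOrientationReversing_sphere_holds n hn o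
    exact sound ⟨φ, (isOrientationReversing_iff o o φ).mp hφ⟩

/-- Consequence: the classes of the standard homotopy spheres `HomotopySphere.sphere o`, `n ≠ 0`,
all coincide (Kervaire–Milnor 1963, §2). [cite: KervaireMilnorAnnals1963, §2 (Lemma 2.1, p. 505)] -/
theorem mk_sphere_eq_mk_sphere (hn : n ≠ 0) (o o' : SmoothOrientation (𝓡 n) (𝕊 n)) :
    mk (HomotopySphere.sphere o) = mk (HomotopySphere.sphere o') :=
  mk_sphere_eq_holds hn o o'

end HomotopySphereClass

/-! ### Named facts: the manifold-level inputs (Kervaire–Milnor 1963, §2) -/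

/-- **The connected sum of two homotopy spheres is a homotopy sphere** (Kervaire–Milnor, *Groups of
homotopy spheres I*, Ann. of Math. 77 (1963), §2, p. 505: "It is clear that the sum of two homotopy
`n`-spheres is a homotopy `n`-sphere"). Relational form over the tree's `IsConnectedSum`: if the
closed smooth `n`-manifold `P` is a connected sum of (the carriers of) two homotopy `n`-spheres,
then `P` is homotopy equivalent to `𝕊ⁿ`. (For `n ≥ 3`: `P` is simply connected with the homology
of a sphere, Seifert–van Kampen, Mayer–Vietoris and Whitehead; `n ≤ 2`: classification. Compactness
of `P` is automatic, `IsConnectedSum.compactSpace`, but kept as a hypothesis.) [cite: KervaireMilnorAnnals1963, §2 p. 505] -/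
def HomotopySphere.nonempty_homotopyEquiv_sphere_of_isConnectedSum : Prop :=
  ∀ (n : ℕ) (S T : HomotopySphere n) (P : Type) [TopologicalSpace P] [T2Space P]
    [SecondCountableTopology P] [ChartedSpace (𝔼 n) P] [IsManifold (𝓡 n) ∞ P] [CompactSpace P],
    IsConnectedSum (𝓡 n) (𝓡 n) (𝓡 n) S.carrier T.carrier P → Nonempty (P ≃ₕ (𝕊 n))

/-- **Associativity of the oriented connected sum** (Kervaire–Milnor, *Groups of homotopy spheres
I* (1963), Lemma 2.1, p. 505: "The connected sum operation is well defined, associative, and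
commutative up to orientation preserving diffeomorphism", for closed connected oriented manifolds;
proof by the disc theorem of Palais (1960) and Cerf (1961)). Relational form: if `(P₁₂, o₁₂)` is an
oriented connected sum `M₁ # M₂`, `(Q, oQ)` one of `P₁₂ # M₃`, `(P₂₃, o₂₃)` one of `M₂ # M₃` and
`(Q', oQ')` one of `M₁ # P₂₃`, then `Q ≅ Q'` by an orientation-preserving diffeomorphism:
`(M₁ # M₂) # M₃ ≅ M₁ # (M₂ # M₃)`. All manifolds closed (compact, as throughout Kervaire–Milnor),
connected, smooth, modelled on `ℝⁿ`. [cite: KervaireMilnorAnnals1963, Lemma 2.1 (p. 505)] -/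
def isOrientedConnectedSum_assoc : Prop :=
  ∀ (n : ℕ) (M₁ M₂ M₃ P₁₂ P₂₃ Q Q' : Type u)
    [TopologicalSpace M₁] [T2Space M₁] [SecondCountableTopology M₁] [ChartedSpace (𝔼 n) M₁]
    [IsManifold (𝓡 n) ∞ M₁] [CompactSpace M₁] [ConnectedSpace M₁]
    [TopologicalSpace M₂] [T2Space M₂] [SecondCountableTopology M₂] [ChartedSpace (𝔼 n) M₂]
    [IsManifold (𝓡 n) ∞ M₂] [CompactSpace M₂] [ConnectedSpace M₂]
    [TopologicalSpace M₃] [T2Space M₃] [SecondCountableTopology M₃] [ChartedSpace (𝔼 n) M₃]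
    [IsManifold (𝓡 n) ∞ M₃] [CompactSpace M₃] [ConnectedSpace M₃]
    [TopologicalSpace P₁₂] [T2Space P₁₂] [SecondCountableTopology P₁₂] [ChartedSpace (𝔼 n) P₁₂]
    [IsManifold (𝓡 n) ∞ P₁₂] [CompactSpace P₁₂] [ConnectedSpace P₁₂]
    [TopologicalSpace P₂₃] [T2Space P₂₃] [SecondCountableTopology P₂₃] [ChartedSpace (𝔼 n) P₂₃]
    [IsManifold (𝓡 n) ∞ P₂₃] [CompactSpace P₂₃] [ConnectedSpace P₂₃]
    [TopologicalSpace Q] [T2Space Q] [SecondCountableTopology Q] [ChartedSpace (𝔼 n) Q]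
    [IsManifold (𝓡 n) ∞ Q] [CompactSpace Q]
    [TopologicalSpace Q'] [T2Space Q'] [SecondCountableTopology Q'] [ChartedSpace (𝔼 n) Q']
    [IsManifold (𝓡 n) ∞ Q'] [CompactSpace Q']
    (o₁ : SmoothOrientation (𝓡 n) M₁) (o₂ : SmoothOrientation (𝓡 n) M₂)
    (o₃ : SmoothOrientation (𝓡 n) M₃) (o₁₂ : SmoothOrientation (𝓡 n) P₁₂)
    (o₂₃ : SmoothOrientation (𝓡 n) P₂₃) (oQ : SmoothOrientation (𝓡 n) Q)
    (oQ' : SmoothOrientation (𝓡 n) Q'),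
    IsOrientedConnectedSum o₁ o₂ o₁₂ → IsOrientedConnectedSum o₁₂ o₃ oQ →
    IsOrientedConnectedSum o₂ o₃ o₂₃ → IsOrientedConnectedSum o₁ o₂₃ oQ' →
    ∃ φ : Q ≃ₘ⟮𝓡 n, 𝓡 n⟯ Q', φ.IsOrientationPreserving oQ oQ'

/-- **`M # Sⁿ = M` for oriented connected sums** (Kervaire–Milnor, *Groups of homotopy spheres I*
(1963), Lemma 2.1, p. 505: "The sphere `Sⁿ` serves as identity element … The proof that `M # Sⁿ`
is diffeomorphic to `M` will be left to the reader"; Kosinski, *Differential Manifolds* (1993),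
VI.(1.3)). Relational form over the tree's `IsOrientedConnectedSum` (oriented sharpening of the tree
fact `isConnectedSum_sphere_self`): a closed connected oriented smooth `n`-manifold `(M, oM)`,
`n ≠ 0`, is itself an oriented connected sum of `(M, oM)` and `(𝕊ⁿ, oS)` for *every* orientation
`oS` of the sphere (choose an orientation-reversing disc `𝔼 n → 𝕊ⁿ`, which exists for either
orientation as `𝕊ⁿ` admits a reflection, and use that the complement of an open disc in `𝕊ⁿ` is a
closed disc filling the hole in `M` back in). `n ≠ 0`: for `n = 0` no reflection of `𝔼 0` exists
and the statement fails for `M = pt`. [cite: KervaireMilnorAnnals1963, Lemma 2.1 (p. 505)] [cite: Kosinski1993, Ch. VI §1 (1.3)] -/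
def isOrientedConnectedSum_sphere_self : Prop :=
  ∀ (n : ℕ) (M : Type u) [TopologicalSpace M] [T2Space M] [SecondCountableTopology M]
    [ChartedSpace (𝔼 n) M] [IsManifold (𝓡 n) ∞ M] [CompactSpace M] [ConnectedSpace M]
    (oM : SmoothOrientation (𝓡 n) M) (oS : SmoothOrientation (𝓡 n) (𝕊 n)),
    n ≠ 0 → IsOrientedConnectedSum oM oS oM

/-- **`Σ # (-Σ)` is h-cobordant to the sphere** (Kervaire–Milnor, *Groups of homotopy spheres I*
(1963), Lemma 2.4, p. 507: "If `M` is a homotopy sphere, then `M # (-M)` bounds a contractible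
manifold", with Lemma 2.3, p. 506: "A simply connected manifold `M` is h-cobordant to the sphere
`Sⁿ` if and only if `M` bounds a contractible manifold"; combined on p. 507, proof of Thm 1.1: "By
Lemmas 2.3, 2.4, each element of `Θₙ` has an inverse"). Relational form: if the closed smooth
manifold `(P, oP)` is an oriented connected sum of a homotopy sphere `(Σ, o)` and its reverse
`(Σ, -o)`, then `P` is h-cobordant (tree notion `Literature.Topology.FourManifolds.IsHCobordant`, unoriented) to `𝕊ⁿ`.
Hypothesis `2 ≤ n`: Lemma 2.3 needs `P` simply connected, which a homotopy `n`-sphere is exactly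
for `n ≥ 2` (the tree fact is used for `n ≥ 5` only). [cite: KervaireMilnorAnnals1963, Lemmas 2.3–2.4 (pp. 506–507) and proof of Thm. 1.1 (p. 507)] -/
def HomotopySphere.isHCobordant_sphere_of_isOrientedConnectedSum_neg : Prop :=
  ∀ (n : ℕ) (S : HomotopySphere n) (P : Type) [TopologicalSpace P] [T2Space P]
    [SecondCountableTopology P] [ChartedSpace (𝔼 n) P] [IsManifold (𝓡 n) ∞ P] [CompactSpace P]
    (oP : SmoothOrientation (𝓡 n) P), 2 ≤ n →
    IsOrientedConnectedSum S.orientation (-S.orientation) oP → Literature.Topology.FourManifolds.IsHCobordant n P (𝕊 n)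

/-- **Homotopy spheres of dimension `1, 2, 3` are diffeomorphic to the standard sphere**, so that
`Θ₁ = Θ₂ = Θ₃ = 0` even for the oriented-diffeomorphism quotient, GIVEN the tree fact
`SPC4.nonemptyDiffeomorphSphere_of_mem` (spc4.S32, `SPC4Wave0.lean`: the smooth Poincaré conjecture
holds in dimensions `1, 2, 3, 5, 6, 12, 56, 61`). Kervaire–Milnor, *Groups of homotopy spheres I*
(1963), p. 507: "Clearly `Θ₁` is zero. For `n ≤ 3`, Munkres [19] and Whitehead [31] have proved
that a topological `n`-manifold has a differentiable structure which is unique up to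
diffeomorphism. It follows that `Θ₂ = 0`. If the Poincaré hypothesis were proved, it would follow
that `Θ₃` is zero" — the Poincaré hypothesis is Perelman's theorem (2002–03). Homotopy spheres
are closed (compact, Hausdorff, second countable), so the tree fact applies verbatim for
`n ∈ {1, 2, 3}`. [cite: KervaireMilnorAnnals1963, §2 p. 507] -/
theorem HomotopySphere.nonempty_diffeomorph_sphere_of_le_three_of
    (h : FourManifolds.nonemptyDiffeomorphSphere_of_mem.{0}) (n : ℕ) (S : HomotopySphere n) (h1 : 1 ≤ n)
    (h3 : n ≤ 3) : Nonempty (S.carrier ≃ₘ⟮𝓡 n, 𝓡 n⟯ (𝕊 n)) := by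
  have hn : n ∈ ({1, 2, 3, 5, 6, 12, 56, 61} : Set ℕ) := by
    interval_cases n <;> simp
  obtain ⟨e⟩ := S.nonempty_homotopyEquiv
  exact h n hn S.carrier S.chartedSpace S.isManifold e

namespace HomotopySphereClass

variable {n : ℕ}

/-- **Associativity of the group law of `Θₙ`, relationally** (Kervaire–Milnor, *Groups of
homotopy spheres I* (1963), Lemma 2.1, p. 505: the connected sum is "associative … up to
orientation preserving diffeomorphism", for *connected* summands): for `n ≠ 0`, if `a # b = ab`,
`b # c = bc`, `ab # c = d` and `a # bc = d'` in the sense of `IsMul`, then `d = d'`. The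
hypothesis `n ≠ 0` is that of the tree fact `isMul_exists`: homotopy `0`-spheres are not
connected, so Lemma 2.1 says nothing about them (and `IsMul` is not vacuous for `n = 0`).
Class-level companion of `Literature.Topology.FourManifolds.isOrientedConnectedSum_assoc` (from which it follows, for `n ≠ 0`,
by transporting oriented connected sums along oriented diffeomorphisms of the summands), in the
style of the tree facts `isMul_exists`, `isMul_unique`. [cite: KervaireMilnorAnnals1963, Lemma 2.1 (p. 505)] -/
def isMul_assoc : Prop :=
  n ≠ 0 → ∀ ⦃a b c ab bc d d' : HomotopySphereClass n⦄,
    IsMul a b ab → IsMul b c bc → IsMul ab c d → IsMul a bc d' → d = d'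

/-! ### The class-level package and the algebra of Theorem 1.1 -/

/-- **The class-level content of Kervaire–Milnor's Lemmas 2.1–2.4 (with Smale's h-cobordism
theorem) in dimension `n`**, i.e. exactly what the proof of Thm 1.1 (Kervaire–Milnor 1963, p. 507)
uses about the relational connected sum `IsMul` on `Θₙ = HomotopySphereClass n`:
products exist (`isMul_exists`; existence of connected sums and p. 505) and are unique
(`isMul_unique`; Lemma 2.1 "well defined"), the operation is associative (Lemma 2.1), the class of
the standard sphere with any orientation is a right unit (Lemma 2.1, "`Sⁿ` serves as identity
element"), and `a # (-a)` is the class of a standard sphere (Lemmas 2.3–2.4 + Smale for `n ≥ 5`).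
Commutativity is not a field: it is the theorem `IsMul.symm`. See `groupLawFacts_of` for its
derivation from the manifold-level facts and `GroupLawFacts.exists_commGroup` for Thm 1.1.
[cite: KervaireMilnorAnnals1963, Lemmas 2.1–2.4 and proof of Thm. 1.1 (pp. 505–507)] -/
structure GroupLawFacts (n : ℕ) : Prop where
  /-- Any two classes have a product (Kervaire–Milnor 1963, §2 p. 505). -/
  exists_isMul : ∀ a b : HomotopySphereClass n, ∃ c, IsMul a b c
  /-- The product is unique (Kervaire–Milnor 1963, Lemma 2.1, "well defined"). -/
  isMul_unique : ∀ ⦃a b c c' : HomotopySphereClass n⦄, IsMul a b c → IsMul a b c' → c = c'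
  /-- The product is associative (Kervaire–Milnor 1963, Lemma 2.1). -/
  isMul_assoc : ∀ ⦃a b c ab bc d d' : HomotopySphereClass n⦄,
    IsMul a b ab → IsMul b c bc → IsMul ab c d → IsMul a bc d' → d = d'
  /-- The standard sphere, with any orientation, is a right unit (Kervaire–Milnor 1963,
  Lemma 2.1). -/
  isMul_sphere : ∀ (o : SmoothOrientation (𝓡 n) (𝕊 n)) (a : HomotopySphereClass n),
    IsMul a (mk (HomotopySphere.sphere o)) a
  /-- `a # (-a)` is a standard sphere (Kervaire–Milnor 1963, Lemmas 2.3–2.4; Smale). -/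
  exists_isMul_neg : ∀ a : HomotopySphereClass n,
    ∃ o : SmoothOrientation (𝓡 n) (𝕊 n), IsMul a a.neg (mk (HomotopySphere.sphere o))

/-- **The algebra of Kervaire–Milnor's Theorem 1.1** (Ann. of Math. 77 (1963), proof on p. 507:
"By Lemmas 2.1 and 2.2 there is a well defined, associative, commutative addition operation in
`Θₙ`. The sphere `Sⁿ` serves as zero element. By Lemmas 2.3, 2.4, each element of `Θₙ` has an
inverse. Therefore `Θₙ` is an additive group."). GIVEN the class-level facts `GroupLawFacts n` and
one orientation `o₀` of `𝕊ⁿ`, the type `Θₙ` carries a commutative group structure whose product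
extends `IsMul`, whose unit is `[𝕊ⁿ, o]` for every orientation `o`, and whose inverse is
orientation reversal. Proof: `a * b := ` the (unique) `c` with `IsMul a b c`; the axioms are
instances of uniqueness; all `[𝕊ⁿ, o]` agree because each is a two-sided unit (`IsMul.symm`).
[cite: KervaireMilnorAnnals1963, Thm. 1.1, proof p. 507] -/
theorem GroupLawFacts.exists_commGroup (h : GroupLawFacts n)
    (o₀ : SmoothOrientation (𝓡 n) (𝕊 n)) :
    ∃ _ : CommGroup (HomotopySphereClass n),
      (∀ a b c : HomotopySphereClass n, IsMul a b c → a * b = c) ∧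
      (∀ o : SmoothOrientation (𝓡 n) (𝕊 n),
        (HomotopySphereClass.mk ⟨𝕊 n, o, ⟨.refl _⟩⟩ : HomotopySphereClass n) = 1) ∧
      ∀ a : HomotopySphereClass n, a⁻¹ = a.neg := by
  choose mul hmul using h.exists_isMul
  -- the unit and its independence of the orientation
  have hsph : ∀ o, HomotopySphereClass.mk (HomotopySphere.sphere o) =
      HomotopySphereClass.mk (HomotopySphere.sphere o₀) := fun o =>
    h.isMul_unique (h.isMul_sphere o₀ (HomotopySphereClass.mk (.sphere o)))
      (h.isMul_sphere o _).symm
  have hassoc : ∀ a b c, mul (mul a b) c = mul a (mul b c) := fun a b c =>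
    h.isMul_assoc (hmul a b) (hmul b c) (hmul (mul a b) c) (hmul a (mul b c))
  have hcomm : ∀ a b, mul a b = mul b a := fun a b => h.isMul_unique (hmul a b) (hmul b a).symm
  have hone : ∀ a, mul (HomotopySphereClass.mk (HomotopySphere.sphere o₀)) a = a := fun a =>
    h.isMul_unique (hmul _ a) (h.isMul_sphere o₀ a).symm
  have hinv : ∀ a, mul a.neg a = HomotopySphereClass.mk (HomotopySphere.sphere o₀) := fun a => by
    obtain ⟨o, ho⟩ := h.exists_isMul_neg a
    exact (h.isMul_unique (hmul a.neg a) ho.symm).trans (hsph o)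
  let G : CommGroup (HomotopySphereClass n) :=
    { mul := mul
      mul_assoc := hassoc
      one := HomotopySphereClass.mk (HomotopySphere.sphere o₀)
      one_mul := hone
      mul_one := fun a => (hcomm a _).trans (hone a)
      inv := HomotopySphereClass.neg
      inv_mul_cancel := hinv
      mul_comm := hcomm }
  exact ⟨G, fun a b c habc => h.isMul_unique (hmul a b) habc, fun o => hsph o, fun a => rfl⟩

/-- On a one-element `Θₙ` (the case `n ≤ 3`) the conclusion of `exists_commGroup_homotopySphereClass`
holds trivially: the trivial group, with inverse `neg` (Kervaire–Milnor 1963, p. 507: `Θ₁`, `Θ₂` are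
zero, and `Θ₃` modulo the Poincaré hypothesis). [cite: KervaireMilnorAnnals1963, §2 p. 507] -/
theorem exists_commGroup_of_subsingleton [Subsingleton (HomotopySphereClass n)]
    (o₀ : SmoothOrientation (𝓡 n) (𝕊 n)) :
    ∃ _ : CommGroup (HomotopySphereClass n),
      (∀ a b c : HomotopySphereClass n, IsMul a b c → a * b = c) ∧
      (∀ o : SmoothOrientation (𝓡 n) (𝕊 n),
        (mk ⟨𝕊 n, o, ⟨.refl _⟩⟩ : HomotopySphereClass n) = 1) ∧
      ∀ a : HomotopySphereClass n, a⁻¹ = a.neg := by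
  let G : CommGroup (HomotopySphereClass n) :=
    { mul := fun _ _ => mk (HomotopySphere.sphere o₀)
      mul_assoc := fun _ _ _ => Subsingleton.elim _ _
      one := mk (HomotopySphere.sphere o₀)
      one_mul := fun _ => Subsingleton.elim _ _
      mul_one := fun _ => Subsingleton.elim _ _
      inv := HomotopySphereClass.neg
      inv_mul_cancel := fun _ => Subsingleton.elim _ _
      mul_comm := fun _ _ => Subsingleton.elim _ _ }
  exact ⟨G, fun _ _ _ _ => Subsingleton.elim _ _, fun _ => Subsingleton.elim _ _, fun _ => rfl⟩

/-- If every homotopy `n`-sphere (`n ≠ 0`) is diffeomorphic to `𝕊ⁿ`, then `Θₙ` is a point: a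
diffeomorphism `Σ ≅ 𝕊ⁿ` out of the connected `Σ` either preserves or reverses the orientations
(`Diffeomorph.isOrientationPreserving_or_isOrientationReversing_holds`), so `[Σ] = [𝕊ⁿ, ±o₀]`, and
`[𝕊ⁿ, -o₀] = [𝕊ⁿ, o₀]` (`mk_sphere_eq_holds`). Kervaire–Milnor 1963, p. 507 (`Θ₁`, `Θ₂` are zero, and
`Θ₃` modulo the Poincaré hypothesis).
[cite: KervaireMilnorAnnals1963, §2 p. 507] -/
theorem subsingleton_of_nonempty_diffeomorph_sphere (hn : n ≠ 0)
    (h : ∀ S : HomotopySphere n, Nonempty (S.carrier ≃ₘ⟮𝓡 n, 𝓡 n⟯ (𝕊 n))) :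
    Subsingleton (HomotopySphereClass n) := by
  obtain ⟨o₀⟩ := (isOrientable_sphere_holds n : Nonempty _)
  suffices hall : ∀ a : HomotopySphereClass n, a = mk (HomotopySphere.sphere o₀) from
    ⟨fun a b => (hall a).trans (hall b).symm⟩
  intro a
  induction a using HomotopySphereClass.ind with
  | h S =>
    obtain ⟨ψ⟩ := h S
    haveI := S.connectedSpace hn
    rcases Diffeomorph.isOrientationPreserving_or_isOrientationReversing_holds ψ (by simp)
      S.orientation o₀ with hψ | hψ
    · exact sound ⟨ψ, hψ⟩
    · exact (sound (⟨ψ, hψ⟩ : S.IsOrientedDiffeomorphic (.sphere (-o₀)))).trans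
        (mk_sphere_eq_holds hn (-o₀) o₀)

/-! ### Reductions of the class-level facts to the manifold-level ones -/

/-- **Products exist in `Θₙ`** (`n ≠ 0`), GIVEN the existence of oriented connected sums of closed
oriented manifolds (tree fact `exists_isOrientedConnectedSum`) and Kervaire–Milnor's remark that
the sum of two homotopy spheres is a homotopy sphere (p. 505,
`HomotopySphere.nonempty_homotopyEquiv_sphere_of_isConnectedSum`): take representatives, form
their oriented connected sum, and take its class. In particular this discharges the tree fact
`isMul_exists` relative to those two facts. [cite: KervaireMilnorAnnals1963, §2 p. 505] -/
theorem exists_isMul_of (hcs : exists_isOrientedConnectedSum.{0} (n := n))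
    (hK1 : HomotopySphere.nonempty_homotopyEquiv_sphere_of_isConnectedSum) (hn : n ≠ 0)
    (a b : HomotopySphereClass n) : ∃ c, IsMul a b c := by
  induction a using HomotopySphereClass.ind with
  | h S =>
    induction b using HomotopySphereClass.ind with
    | h T =>
      haveI := S.nonempty
      haveI := T.nonempty
      obtain ⟨P, _, _, _, _, _, _, oP, hP⟩ := hcs hn S.carrier T.carrier S.orientation T.orientation
      obtain ⟨e⟩ := hK1 n S T P hP.isConnectedSum
      exact ⟨mk ⟨P, oP, ⟨e⟩⟩, S, T, ⟨P, oP, ⟨e⟩⟩, rfl, rfl, rfl, hP⟩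

/-- `isMul_exists` (tree fact) follows from `exists_isOrientedConnectedSum` and
`HomotopySphere.nonempty_homotopyEquiv_sphere_of_isConnectedSum` (Kervaire–Milnor 1963, §2 p. 505).
[cite: KervaireMilnorAnnals1963, §2 p. 505] -/
theorem isMul_exists_of (hcs : exists_isOrientedConnectedSum.{0} (n := n))
    (hK1 : HomotopySphere.nonempty_homotopyEquiv_sphere_of_isConnectedSum) :
    isMul_exists (n := n) :=
  fun hn a b => exists_isMul_of hcs hK1 hn a b

/-- **`[𝕊ⁿ, o]` is a right unit of `Θₙ`** for every orientation `o` (`n ≠ 0`), GIVEN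
`M # Sⁿ = M` in oriented relational form (`isOrientedConnectedSum_sphere_self`; Kervaire–Milnor
1963, Lemma 2.1: "The sphere `Sⁿ` serves as identity element"): the representative itself is an
oriented connected sum of itself and the sphere. [cite: KervaireMilnorAnnals1963, Lemma 2.1 (p. 505)] -/
theorem isMul_sphere_of (hK3 : isOrientedConnectedSum_sphere_self.{0}) (hn : n ≠ 0)
    (o : SmoothOrientation (𝓡 n) (𝕊 n)) (a : HomotopySphereClass n) :
    IsMul a (mk (HomotopySphere.sphere o)) a := by
  induction a using HomotopySphereClass.ind with
  | h S =>
    haveI := S.connectedSpace hn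
    exact ⟨S, .sphere o, S, rfl, rfl, rfl, hK3 n S.carrier S.orientation o hn⟩

/-- **Inverses in `Θₙ`**: `a # (-a) = [𝕊ⁿ, o]` for some orientation `o`, GIVEN existence of
oriented connected sums (`exists_isOrientedConnectedSum`), that sums of homotopy spheres are
homotopy spheres (p. 505), Kervaire–Milnor's Lemmas 2.3–2.4 (`Σ # (-Σ)` is h-cobordant to `Sⁿ`,
`HomotopySphere.isHCobordant_sphere_of_isOrientedConnectedSum_neg`, `n ≥ 2`) and that h-cobordant
homotopy `n`-spheres are diffeomorphic (hypothesis `hcob`; this is Smale's h-cobordism theorem,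
available for `n ≥ 5`: Kervaire–Milnor 1963 p. 505, tree facts
`HomotopySphere.isHCobordant_iff_nonempty_diffeomorph_of_five_le` and
`SPC4.nonempty_diffeomorph_of_isHCobordant_of_five_le`). Proof: with `a = [Σ]`, form
`(P, oP) = Σ # (-Σ)`; then `P ≅ 𝕊ⁿ` by a diffeomorphism which preserves or reverses `(oP, o₀)`,
i.e. `[P, oP] = [𝕊ⁿ, ±o₀]`.
[cite: KervaireMilnorAnnals1963, Lemmas 2.3–2.4 and proof of Thm. 1.1 (p. 507); p. 505 (Smale)] -/
theorem exists_isMul_neg_of (hcs : exists_isOrientedConnectedSum.{0} (n := n))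
    (hK1 : HomotopySphere.nonempty_homotopyEquiv_sphere_of_isConnectedSum)
    (hK4 : HomotopySphere.isHCobordant_sphere_of_isOrientedConnectedSum_neg)
    (hcob : ∀ U V : HomotopySphere n,
      U.IsHCobordant V → Nonempty (U.carrier ≃ₘ⟮𝓡 n, 𝓡 n⟯ V.carrier))
    (h2 : 2 ≤ n) (o₀ : SmoothOrientation (𝓡 n) (𝕊 n)) (a : HomotopySphereClass n) :
    ∃ o : SmoothOrientation (𝓡 n) (𝕊 n), IsMul a a.neg (mk (HomotopySphere.sphere o)) := by
  have hn : n ≠ 0 := by omega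
  induction a using HomotopySphereClass.ind with
  | h S =>
    haveI := S.nonempty
    obtain ⟨P, _, _, _, _, _, _, oP, hP⟩ :=
      hcs hn S.carrier S.carrier S.orientation (-S.orientation)
    obtain ⟨e⟩ := hK1 n S S.neg P hP.isConnectedSum
    set U : HomotopySphere n := ⟨P, oP, ⟨e⟩⟩ with hU_def
    have hU : IsMul (mk S) (mk S).neg (mk U) := ⟨S, S.neg, U, rfl, rfl, rfl, hP⟩
    have hh : U.IsHCobordant (.sphere o₀) := hK4 n S P oP h2 hP
    obtain ⟨ψ⟩ := hcob U (.sphere o₀) hh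
    haveI : ConnectedSpace P := U.connectedSpace hn
    rcases Diffeomorph.isOrientationPreserving_or_isOrientationReversing_holds ψ (by simp)
      oP o₀ with hψ | hψ
    · exact ⟨o₀, (sound (⟨ψ, hψ⟩ : U.IsOrientedDiffeomorphic (.sphere o₀))) ▸ hU⟩
    · exact ⟨-o₀, (sound (⟨ψ, hψ⟩ : U.IsOrientedDiffeomorphic (.sphere (-o₀)))) ▸ hU⟩

/-- **`GroupLawFacts n` for `n ≥ 5` from the manifold-level facts** (Kervaire–Milnor 1963, §2):
existence of oriented connected sums, sums of homotopy spheres are homotopy spheres (p. 505),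
uniqueness and associativity of the sum on classes (Lemma 2.1; class-level tree fact `isMul_unique`
and `isMul_assoc`), `M # Sⁿ = M` (Lemma 2.1), `Σ # (-Σ) ∼ₕ Sⁿ` (Lemmas 2.3–2.4) and Smale's
h-cobordism theorem (p. 505). [cite: KervaireMilnorAnnals1963, §2 (Lemmas 2.1–2.4, pp. 505–507)] -/
theorem groupLawFacts_of (h5 : 5 ≤ n)
    (hcs : exists_isOrientedConnectedSum.{0} (n := n))
    (hK1 : HomotopySphere.nonempty_homotopyEquiv_sphere_of_isConnectedSum)
    (hU : isMul_unique (n := n)) (hA : isMul_assoc (n := n))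
    (hK3 : isOrientedConnectedSum_sphere_self.{0})
    (hK4 : HomotopySphere.isHCobordant_sphere_of_isOrientedConnectedSum_neg)
    (hcob : HomotopySphere.isHCobordant_iff_nonempty_diffeomorph_of_five_le (n := n)) :
    GroupLawFacts n := by
  have hn : n ≠ 0 := by omega
  obtain ⟨o₀⟩ := (isOrientable_sphere_holds n : Nonempty _)
  exact
    { exists_isMul := exists_isMul_of hcs hK1 hn
      isMul_unique := fun _ _ _ _ h h' => hU h h'
      isMul_assoc := fun _ _ _ _ _ _ _ h₁ h₂ h₃ h₄ => hA hn h₁ h₂ h₃ h₄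
      isMul_sphere := isMul_sphere_of hK3 hn
      exists_isMul_neg :=
        exists_isMul_neg_of hcs hK1 hK4 (fun U V h => (hcob h5 U V).mp h) (by omega) o₀ }

end HomotopySphereClass

/-! ### Assembly -/

/-- **Kervaire–Milnor's Theorem 1.1 for `Θₙ = HomotopySphereClass n`, `n ≠ 0, 4`, from its
class-level inputs**: GIVEN that homotopy spheres of dimension `≤ 3` are standard (tree fact
`SPC4.nonemptyDiffeomorphSphere_of_mem`, spc4.S32: Kervaire–Milnor 1963 p. 507 + Perelman) and the
class-level Lemmas 2.1–2.4 (`HomotopySphereClass.GroupLawFacts n`) in every dimension `n ≥ 5`, the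
named fact `exists_commGroup_homotopySphereClass` holds. Dimensions `≤ 3`: `Θₙ` is a point
(`subsingleton_of_nonempty_diffeomorph_sphere`); dimensions `≥ 5`:
`GroupLawFacts.exists_commGroup`; an orientation of `𝕊ⁿ` exists by `isOrientable_sphere_holds`.
[cite: KervaireMilnorAnnals1963, Thm. 1.1 (proof p. 507)] -/
theorem exists_commGroup_homotopySphereClass_of_groupLawFacts
    (hlow : FourManifolds.nonemptyDiffeomorphSphere_of_mem.{0})
    (hhigh : ∀ n : ℕ, 5 ≤ n → HomotopySphereClass.GroupLawFacts n) :
    exists_commGroup_homotopySphereClass := by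
  intro n h0 h4
  obtain ⟨o₀⟩ := (isOrientable_sphere_holds n : Nonempty _)
  by_cases h3 : n ≤ 3
  · haveI := HomotopySphereClass.subsingleton_of_nonempty_diffeomorph_sphere h0
      (fun S => HomotopySphere.nonempty_diffeomorph_sphere_of_le_three_of hlow n S
        (Nat.one_le_iff_ne_zero.mpr h0) h3)
    exact HomotopySphereClass.exists_commGroup_of_subsingleton o₀
  · exact (hhigh n (by omega)).exists_commGroup o₀

/-- **Kervaire–Milnor's Theorem 1.1 for `Θₙ`, `n ≠ 0, 4`, from the manifold-level facts**: the
named fact `exists_commGroup_homotopySphereClass` follows from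
(i) the smooth Poincaré conjecture in dimensions `≤ 3` (`SPC4.nonemptyDiffeomorphSphere_of_mem`,
spc4.S32; p. 507 + Perelman),
(ii) existence of oriented connected sums `exists_isOrientedConnectedSum` (§2),
(iii) sums of homotopy spheres are homotopy spheres (p. 505),
(iv) the class-level uniqueness `HomotopySphereClass.isMul_unique` and associativity
`HomotopySphereClass.isMul_assoc` (Lemma 2.1),
(v) `isOrientedConnectedSum_sphere_self` (Lemma 2.1),
(vi) `HomotopySphere.isHCobordant_sphere_of_isOrientedConnectedSum_neg` (Lemmas 2.3–2.4), and
(vii) Smale's h-cobordism theorem `HomotopySphere.isHCobordant_iff_nonempty_diffeomorph_of_five_le`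
(p. 505). [cite: KervaireMilnorAnnals1963, Thm. 1.1, §2 pp. 505–507] [cite: MilnorHCobordism1965, Thm. 9.1] -/
theorem exists_commGroup_homotopySphereClass_of
    (hlow : FourManifolds.nonemptyDiffeomorphSphere_of_mem.{0})
    (hcs : ∀ n : ℕ, exists_isOrientedConnectedSum.{0} (n := n))
    (hK1 : HomotopySphere.nonempty_homotopyEquiv_sphere_of_isConnectedSum)
    (hU : ∀ n : ℕ, HomotopySphereClass.isMul_unique (n := n))
    (hA : ∀ n : ℕ, HomotopySphereClass.isMul_assoc (n := n))
    (hK3 : isOrientedConnectedSum_sphere_self.{0})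
    (hK4 : HomotopySphere.isHCobordant_sphere_of_isOrientedConnectedSum_neg)
    (hcob : ∀ n : ℕ, HomotopySphere.isHCobordant_iff_nonempty_diffeomorph_of_five_le (n := n)) :
    exists_commGroup_homotopySphereClass :=
  exists_commGroup_homotopySphereClass_of_groupLawFacts hlow fun n h5 =>
    HomotopySphereClass.groupLawFacts_of h5 (hcs n) hK1 (hU n) (hA n) hK3 hK4 (hcob n)

end Literature.Topology.FourManifolds
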